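import Literature.Topology.FourManifolds.HandleAttachingMapsAssoc
import Literature.Topology.FourManifolds.HandleAttachingMapsTransport
import Summits.SmoothPoincare4.SmoothPoincare4.Theorems.ConvexBisectionAcyclicBisectionExistsDualHandleSwap
import HarnessLib

/-!
# Dual handles, II: the belt tube of an attached 2-handle is an attaching map of the attached
# manifold (Milnor's dual handle in Kosinski's corner-free model)
(brick T3a-1 of the sub-goal T3 "the complement piece is the cap with the DUAL handles" of stub
`stub_steinRealisation` (NF6), line `modp-braid-orbits` r11, crux
`ConvexBisection.AcyclicBisectionExists`, item stmt-SmoothPoincare4-10508; wave 1, lead c5)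

Sequel of `…DualHandleSwap.lean` (the block swap `σ : T ≅ {x_μ ≠ 0} ⊆ D⁴ ∖ S`, `swapTube`,
`swapPH`, `beltCirclePt`).  For a simultaneous attachment `P = M ∪_{h̄} (handles)` with data `D`
(`HandleAttachingMap.MultiAttachmentData`, handle embeddings `D.jB i : D⁴ ∖ S → P`):

* **`beltMap D i : HandleAttachingMap 3 2 P`** — the belt tube `D.jB i ∘ σ : T → P` of the `i`-th
  handle IS an attaching map of a 2-handle on `P`: a smooth embedding
  (`IsSmoothEmbedding.comp_openPartialHomeomorph`) with open range sending `T ∩ ∂D⁴` into `∂P`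
  (`boundary_closedBall`, `mem_boundary_opens_iff`, `mem_boundary_iff_of_isSmoothEmbedding`);
* its attaching circle is the BELT CIRCLE `θ ↦ D.jB i (0, 0, θ)` (`attachingCircle_beltMap`), its
  attaching sphere the belt sphere `D.jB i {|x_μ| = 1}` (`core_beltMap`), its range the belt tube
  `D.jB i {x_μ ≠ 0}` (`range_beltMap`); the belt maps of distinct handles have disjoint ranges
  (`pairwise_disjoint_range_beltMap`), and the belt spheres miss the base piece
  `D.jA (M ∖ ⋃ h̄ᵢ(S))` (`jA_not_mem_core_beltMap`: belt-sphere points are glued to nothing) and the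
  other handles (`jB_not_mem_core_beltMap`);
* `helper_dualAttachingMap_beltMap` (registered) — the package, in tree vocabulary only.

This is the first node (T3a-1) of the dual-handle presentation of the complement piece `W₂` of a
sorted fibred model (Baykur 2006, proof of Thm. 5.1: `W₂ = M ∖ X₊` is the cap with the handles dual
to the negative Lefschetz handles; Milnor 1965 §3, Kosinski 1993 VII §1: the dual handle is
attached along the belt sphere): the dual attaching maps on the cap are the boundary tubes
(`HandleAttachingMap.boundaryTube`, `AttachingMapBoundaryTube.lean`) of these belt maps pushed
through the seam diffeomorphism and a collar of the cap (`TubeAttachData.attachingMap`,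
`HandleAttachingMapOfTube.lean`).  Everything here is proved; no named facts.

## References
* A. A. Kosinski, *Differential Manifolds*, Academic Press (1993), VI §6, VI §8, VII §1. [Kosinski1993]
* J. Milnor, *Lectures on the h-cobordism theorem* (1965), §3 (dual handles). [MilnorHCobordism1965]
* R. E. Gompf, A. I. Stipsicz, *4-Manifolds and Kirby Calculus* (1999), §8.2, pp. 289–291.
  [GompfStipsicz1999]
* R. İ. Baykur, *Kähler decomposition of 4-manifolds*, AGT 6 (2006), proof of Thm. 5.1. [Baykur2006]
-/

noncomputable section

-- the prescribed namespace `Summit.<P>.<Sub>.…` duplicates `SmoothPoincare4` (P = Sub)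
set_option linter.dupNamespace false

open scoped Manifold ContDiff Topology

namespace Summit.SmoothPoincare4.SmoothPoincare4.Theorems.AcyclicBisectionExists.ModpBraidOrbits

open Set Function Filter Metric Topology
open Literature.Topology.FourManifolds Literature.Topology.FourManifolds.HandleAttachingMap

universe u v

/-! ### §4 The belt map of a handle of a multi-attachment -/

section BeltMap

variable {ι : Type*} [Finite ι] {M : Type u} [TopologicalSpace M] [T2Space M]
  [ChartedSpace (EuclideanHalfSpace 4) M] {h : ι → HandleAttachingMap 3 2 M}
  {P : Type v} [TopologicalSpace P] [ChartedSpace (EuclideanHalfSpace 4) P]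

/-- **The belt tube `D.jB i ∘ σ : T → P` of the `i`-th handle is a smooth embedding** (the handle
embedding `D.jB i` precomposed with the partial diffeomorphism `σ : T ⇀ D⁴ ∖ S`).
[cite: Kosinski1993, VI §6] -/
theorem isSmoothEmbedding_jB_comp_swapTube (D : MultiAttachmentData h (𝓡∂ 4) P) (i : ι) :
    Manifold.IsSmoothEmbedding (𝓡∂ 4) (𝓡∂ 4) ∞ (D.jB i ∘ swapTube) :=
  (D.hjB i).1.comp_openPartialHomeomorph swapPH swapPH_source
    (contMDiff_swapTube.contMDiffOn.congr fun _ _ => rfl) contMDiffOn_swapPH_symm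

/-- **The belt map of the `i`-th handle: the belt tube `D.jB i ∘ σ : T → P` is an attaching map
of a 2-handle on the attached manifold `P = M ∪_{h̄} (handles)`** — Milnor's dual handle read in
Kosinski's corner-free model: a smooth embedding with open range (`D.jB i` is open) sending
`T ∩ ∂D⁴` into `∂P` (`σ` preserves `∂D⁴ = {‖x‖ = 1}`, the open submanifold `D⁴ ∖ S ⊆ D⁴` and the
open smooth embedding `D.jB i` preserve boundary points).  Its attaching circle is the belt circle
of the handle. [cite: MilnorHCobordism1965, §3] -/
def beltMap (D : MultiAttachmentData h (𝓡∂ 4) P) (i : ι) : HandleAttachingMap 3 2 P where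
  toFun := D.jB i ∘ swapTube
  isSmoothEmbedding := isSmoothEmbedding_jB_comp_swapTube D i
  isOpen_range := by
    rw [range_comp]
    exact D.isOpenMap_jB i _ isOpen_range_swapTube
  isBoundaryPoint y hy := by
    have h1 : ((swapTube y : ↥(beltPiece 3 2)) : closedBall (0 : EuclideanSpace ℝ (Fin 4)) 1) ∈
        (𝓡∂ 4).boundary (closedBall (0 : EuclideanSpace ℝ (Fin 4)) 1) := by
      rw [boundary_closedBall]
      show ‖_‖ = 1
      rw [coe_coe_swapTube, norm_swapIso]
      exact hy
    have h2 : swapTube y ∈ (𝓡∂ 4).boundary ↥(beltPiece 3 2) := (mem_boundary_opens_iff _ _).2 h1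
    exact (mem_boundary_iff_of_isSmoothEmbedding (D.hjB i).1 (D.hjB i).2 _).2 h2

variable (D : MultiAttachmentData h (𝓡∂ 4) P) (i : ι)

/-- The belt map on points. [folklore] -/
@[simp] theorem beltMap_apply (y : ↥(handleTube 3 2)) : (beltMap D i).toFun y = D.jB i (swapTube y) :=
  rfl

/-- **The attaching circle of the belt map is the belt circle `θ ↦ D.jB i (0, 0, θ)`.**
[cite: MilnorHCobordism1965, §3] -/
@[simp] theorem attachingCircle_beltMap (θ : sphere (0 : EuclideanSpace ℝ (Fin 2)) 1) :
    (beltMap D i).attachingCircle θ = D.jB i (beltCirclePt θ) := rfl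

/-- **The range of the belt map is the belt tube `D.jB i {x_μ ≠ 0}`.** [cite: Kosinski1993, VI §6] -/
theorem range_beltMap :
    range (beltMap D i).toFun = D.jB i '' {b : ↥(beltPiece 3 2) |
      muSq 2 ((b : closedBall (0 : EuclideanSpace ℝ (Fin 4)) 1) : EuclideanSpace ℝ (Fin 4)) ≠ 0} := by
  rw [← range_swapTube, ← range_comp]; rfl

/-- Membership in the attaching sphere of the belt map: **it is the belt sphere
`D.jB i {|x_μ| = 1}`**. [cite: Kosinski1993, VI §6] -/
theorem mem_core_beltMap_iff {p : P} :
    p ∈ (beltMap D i).core ↔ ∃ b : ↥(beltPiece 3 2),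
      muSq 2 ((b : closedBall (0 : EuclideanSpace ℝ (Fin 4)) 1) : EuclideanSpace ℝ (Fin 4)) = 1 ∧
        D.jB i b = p := by
  rw [mem_core_iff]
  constructor
  · rintro ⟨y, hy, rfl⟩
    exact ⟨swapTube y, by rw [coe_coe_swapTube, muSq_swapIso]; exact hy, rfl⟩
  · rintro ⟨b, hb, rfl⟩
    obtain ⟨θ, rfl⟩ := exists_beltCirclePt_eq hb
    exact ⟨coreTubePt θ, lamSq_corePt θ, rfl⟩

/-- The attaching sphere of the belt map is the belt sphere. [cite: Kosinski1993, VI §6] -/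
theorem core_beltMap :
    (beltMap D i).core = D.jB i '' {b : ↥(beltPiece 3 2) |
      muSq 2 ((b : closedBall (0 : EuclideanSpace ℝ (Fin 4)) 1) : EuclideanSpace ℝ (Fin 4)) = 1} := by
  ext p
  rw [mem_core_beltMap_iff, mem_image]
  simp only [mem_setOf_eq]

/-- The attaching sphere of the belt map is the image of the belt circle. [folklore] -/
theorem core_beltMap_eq_range : (beltMap D i).core = range fun θ => D.jB i (beltCirclePt θ) := by
  rw [← range_attachingCircle]; rfl

/-- **The belt maps of distinct handles have disjoint ranges** (the handles are disjoint).
[cite: Kosinski1993, VI §6] -/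
theorem pairwise_disjoint_range_beltMap :
    Pairwise fun i j => Disjoint (range (beltMap D i).toFun) (range (beltMap D j).toFun) := by
  intro i j hij
  show Disjoint (range (D.jB i ∘ swapTube)) (range (D.jB j ∘ swapTube))
  exact (D.disjointB hij).mono (range_comp_subset_range _ _) (range_comp_subset_range _ _)

/-- **The belt spheres miss the base piece**: no point `D.jA a` lies on a belt sphere (a glued
handle point `α(y)`, `y ∈ T ∖ S`, has `x_λ ≠ 0`, while belt-sphere points have `x_λ = 0`).
[cite: Kosinski1993, VI §6] -/
theorem jA_not_mem_core_beltMap (a : ↥(coresComplement h)) : D.jA a ∉ (beltMap D i).core := by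
  rw [mem_core_beltMap_iff]
  rintro ⟨b, hb, he⟩
  have hrel : (h i).glueRel (a : M) (b : closedBall (0 : EuclideanSpace ℝ (Fin 4)) 1) :=
    (D.glue i a b).1 he.symm
  exact hrel.lamSq_ne_zero (lamSq_eq_zero_of_muSq_eq_one (mem_closedBall_zero_iff.1 b.1.2) hb).1

/-- The belt sphere of the `i`-th handle misses the other handles. [cite: Kosinski1993, VI §6] -/
theorem jB_not_mem_core_beltMap {j : ι} (hji : j ≠ i) (b : ↥(beltPiece 3 2)) :
    D.jB j b ∉ (beltMap D i).core := by
  rw [mem_core_beltMap_iff]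
  rintro ⟨b', -, he⟩
  exact Set.disjoint_left.1 (D.disjointB hji) (mem_range_self b) ⟨b', he⟩

/-- The belt circle lies in `∂P`. [cite: Kosinski1993, VI §6] -/
theorem isBoundaryPoint_jB_beltCirclePt (θ : sphere (0 : EuclideanSpace ℝ (Fin 2)) 1) :
    (𝓡∂ 4).IsBoundaryPoint (D.jB i (beltCirclePt θ)) :=
  (beltMap D i).isBoundaryPoint_attachingCircle θ

/-- The belt-circle point `D.jB i (0, 0, θ)` is not a point of the base piece. [folklore] -/
theorem jA_ne_jB_beltCirclePt (a : ↥(coresComplement h)) (θ : sphere (0 : EuclideanSpace ℝ (Fin 2)) 1) :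
    D.jA a ≠ D.jB i (beltCirclePt θ) := fun he =>
  jA_not_mem_core_beltMap D i a (he ▸ (beltMap D i).attachingCircle_mem_core θ)

end BeltMap

/-! ### §5 Registered helper -/

/-- **Registered helper `helper_dualAttachingMap_beltMap` (sub-goal T3a-1 of NF6 `stub_steinRealisation`,
wave 1, lead c5): the belt tubes of a multi-attachment are attaching maps of the attached manifold.**
For `P = M ∪_{h̄} (handles)` with data `D` there are attaching maps `q i : T → P` of 2-handles on `P`
(namely `beltMap D i = D.jB i ∘ σ`) with: `q i y = D.jB i (σ y)`, `σ (x₀, x₁, x₂, x₃) = (x₂, x₃, x₀, x₁)`;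
pairwise disjoint ranges; range the belt tube `D.jB i {x_μ ≠ 0}`; attaching sphere the belt sphere
`D.jB i {|x_μ| = 1}`, which misses the base piece `D.jA (M ∖ ⋃ h̄ᵢ(S))`.  Milnor (1965) §3 /
Kosinski (1993) VII §1: the dual handle is attached along the belt sphere. [cite: MilnorHCobordism1965, §3] -/
theorem helper_dualAttachingMap_beltMap :
    ∀ {ι : Type} [Finite ι] {M : Type} [TopologicalSpace M] [T2Space M]
      [ChartedSpace (EuclideanHalfSpace 4) M]
      {h : ι → Literature.Topology.FourManifolds.HandleAttachingMap 3 2 M}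
      {P : Type} [TopologicalSpace P] [ChartedSpace (EuclideanHalfSpace 4) P]
      (D : Literature.Topology.FourManifolds.HandleAttachingMap.MultiAttachmentData h (𝓡∂ 4) P),
      ∃ q : ι → Literature.Topology.FourManifolds.HandleAttachingMap 3 2 P,
        (∀ (i : ι) (y : ↥(Literature.Topology.FourManifolds.handleTube 3 2)),
          ∃ b : ↥(Literature.Topology.FourManifolds.beltPiece 3 2),
            ((b : Metric.closedBall (0 : EuclideanSpace ℝ (Fin 4)) 1) : EuclideanSpace ℝ (Fin 4)) =
              WithLp.toLp 2
                ![((y : Metric.closedBall (0 : EuclideanSpace ℝ (Fin 4)) 1) : EuclideanSpace ℝ (Fin 4)) 2,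
                  ((y : Metric.closedBall (0 : EuclideanSpace ℝ (Fin 4)) 1) : EuclideanSpace ℝ (Fin 4)) 3,
                  ((y : Metric.closedBall (0 : EuclideanSpace ℝ (Fin 4)) 1) : EuclideanSpace ℝ (Fin 4)) 0,
                  ((y : Metric.closedBall (0 : EuclideanSpace ℝ (Fin 4)) 1) : EuclideanSpace ℝ (Fin 4)) 1] ∧
            (q i).toFun y = D.jB i b) ∧
        (Pairwise fun i j => Disjoint (Set.range (q i).toFun) (Set.range (q j).toFun)) ∧
        (∀ i, Set.range (q i).toFun = D.jB i ''
          {b | Literature.Topology.FourManifolds.muSq 2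
            ((b : Metric.closedBall (0 : EuclideanSpace ℝ (Fin 4)) 1) : EuclideanSpace ℝ (Fin 4)) ≠ 0}) ∧
        (∀ i, (q i).core = D.jB i ''
          {b | Literature.Topology.FourManifolds.muSq 2
            ((b : Metric.closedBall (0 : EuclideanSpace ℝ (Fin 4)) 1) : EuclideanSpace ℝ (Fin 4)) = 1}) ∧
        (∀ i a, D.jA a ∉ (q i).core) := by
  intro ι _ M _ _ _ h P _ _ D
  refine ⟨fun i => beltMap D i, fun i y => ⟨swapTube y, ?_, rfl⟩,
    pairwise_disjoint_range_beltMap D, fun i => range_beltMap D i, fun i => core_beltMap D i,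
    fun i a => jA_not_mem_core_beltMap D i a⟩
  rw [coe_coe_swapTube]
  ext j
  fin_cases j <;> simp

end Summit.SmoothPoincare4.SmoothPoincare4.Theorems.AcyclicBisectionExists.ModpBraidOrbits

end
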